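import Summits.QuantumFields.BalabanUV.T4Continuum.Support.RegularBackgroundTower
import Literature.MathematicalPhysics.QuantumFieldTheory.Balaban1983to89.UnitaryModel
import Literature.MathematicalPhysics.QuantumFieldTheory.Balaban1983to89.Setup

/-!
# SUBSTRATE — the [dict] «V1 ↔ V2»: a lattice gauge field of `Setup` (bond variables `U(b) ∈ G` on `Site P j`) read through a
# matrix representation `ι : G →* M_o(ℂ)` AS the transporter data `R` of the NE2 matrix vocabulary (`Tor N`, `siteMul`,
# `ColourCovariantLaplacian.covDc ∕ covLapC`, `RegularBackgroundTower.RegularTransporters`) — so that the covariant lattice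
# operators of [I] (2.12)–(2.14) ∕ [II] (1.23) become FUNCTIONS OF THE BACKGROUND `U`, typed once

Cell `pub-balaban`, SUBSTRATE cell, seat `b2b-balaban-substrate-p1` («instances first»); item S-VOC-1 of
`substrate/SUBSTRATE-MAP.md` (typer v0.1 §2: «V1 ↔ V2 dictionary: `Site P j ≃ Tor (fun _ : Fin P.d => P.sitesPerDir j)` (definitional),
gauge field ↦ transporters `R μ x := ι (U ⟨x, μ⟩)` along a unitary representation `ι : G →* Matrix o o ℂ`, … ↦ `RegularTransporters` size
letter»).  Summits-side under the LEAN PLACEMENT RULE (cell modelling + bookkeeping; NOT a Literature module).  HONEST FRAMING: rung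
(B)+1 of the FINITE-VOLUME T⁴ programme — NOT infinite volume, NOT a mass gap, NOT the Clay problem; spine PROVED 0∕9.  This file
asserts NOTHING about Bałaban's backgrounds: it is a DICTIONARY (definitions + definitional∕algebraic identities); every regularity
statement below is an `↔`∕`→` between a V1 wording and a V2 wording of the SAME hypothesis, never a fact.
HONEST DEPENDENCY (cell line, verbatim): continuum YM on T⁴ ⇐ BetaPertH ∧ nine spine estimates (0/9 proved); BetaPertH ⇐ (D1) ∧
(D4) ∧ CAP+tail; G-an2-4 gates asym, D1 and NE2/3/4.

VOCABULARIES (typer ruling V-1).  V1 = `Setup` (`Site P j = Fin P.d → ZMod (P.sitesPerDir j)`, `GaugeField P j G = PBond P j → G`,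
abstract `[GaugeGroup G]` with `dist1`) — the vocabulary of the CARRIERS OF RECORD (p207668).  V2 = the NE2 lineage's matrices over
`Tor N := (μ : Fin d) → ZMod (N μ)`, vector index `Tor N × Fin d`, colour `o`, transporters `R : Fin d → (Tor N × Fin d → Matrix o o ℂ)`
entering `covDc N c R ν = c·(siteMul (R ν)·(S_ν ⊗ 1) − 1)` («R_ν(x) ∈ M_o(ℂ), e.g. the adjoint representation of U(x, x + ηe_ν)»), and
the tower index `idx L M k = Tor (fine (lev L k) M) × Fin d` (spacing `L^{−k}` over the unit torus of periods `M`).  V3 is item S-VOC-2.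

WHAT IS TYPED HERE.
* §1 CHARTS.  `siteTor P j : Site P j ≃ Tor (modAt P j)` with `modAt P j := fun _ => P.sitesPerDir j` — DEFINITIONAL (`Equiv.refl`);
  `Site.shift` IS `· + unitVec` (`siteTor_shift`).  The TOWER chart of a run: with `unitMod P := fun _ =>
  2·L^m` (sites per direction of the unit lattice `T_1`) and NE2's level `k` ↔ V1's level `j` whenever `j + k = P.K` (V1 counts DOWN
  from the finest lattice `j = 0`, NE2 counts UP from the unit lattice `k = 0`), `siteIdx P h : Site P j ≃ Tor (fine (lev P.L k)
  (unitMod P))` along `P.sitesPerDir j = L^k·(2L^m)` (`sitesPerDir_eq_fine`), additive and shift-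
  compatible (`siteIdx_shift`).
* §2 TRANSPORTERS OF A GAUGE FIELD relative to ANY chart `e : Site P j ≃ Tor N` and ANY monoid representation `ι : G →* Matrix o o ℂ`:
  vector `transV e ι U ν (x, μ) := ι (U ⟨e⁻¹ x, ν⟩)` (component-blind, `transV_eq_transS`) and scalar `transS e ι U ν x := ι (U ⟨e⁻¹ x,
  ν⟩)`; `U = 1 ↦ R = 1` (`transV_one`); the GAUGE LAW `transV e ι (U^u) ν (x, μ) = ι(u x)·transV e ι U ν (x, μ)·ι((u (x + e_ν))⁻¹)`
  (`transV_gaugeAct`, [Balaban1985Averaging] (8) p. 19 read through `ι`); unitarity and norm one when `ι` is unitary-valued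
  (`transV_mem_unitaryGroup`, `norm_transV`); and THE SIZE LETTER: when `ι` realises the gauge group's `dist1` (`‖ι g − 1‖ = dist1 g`,
  which is `rfl` for every `GaugeGroup.ofUnitaryRep` — `GaugeGroup.ofUnitaryRep_dist1` — e.g. the tree's `U(n)`, `SU(n)` instances)
  `‖transV e ι U ν (x, μ) − 1‖ = dist1 (U ⟨e⁻¹x, ν⟩)` (`norm_transV_sub_one`).
* §3 THE COVARIANT VECTOR LAPLACIAN OF A GAUGE FIELD `covLapOf e ι c U := covLapC N c (transV e ι U)` — the V2 operator AT V1 data —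
  with `covDc_transV_one : covDc N c (transV e ι 1) ν = ∇_ν ⊗ 1` and `covLapOf_one : covLapOf e ι c 1 = lapC N c` (the free
  Laplacian lifted to colour: NE2's tier-A object BY NAME).
* §4 THE TOWER OF A RUN: for a V1 family of level configurations `U : (j : ℕ) → GaugeField P j G` (one background per lattice
  `T^{(j)}`), `towerOf P ι U : (k : ℕ) → Fin P.d → (idx P.L (unitMod P) k → Matrix o o ℂ)` (levels `k ≤ P.K` through `siteIdx`, the
  junk levels `k > P.K` — no V1 lattice — set to `1`), and THE (3.35)-SHAPE CLASS IN V1 WORDS: `regularTransporters_towerOf` — bond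
  variables within `α·L^{−k}` of `1` in `dist1` and `ι`-images lattice-Lipschitz with constant `β·L^{−2k}` at every level `j = P.K − k`
  GIVE `RegularTransporters P.L (unitMod P) (towerOf P ι U) α β` (row NE2 B5's hypothesis structure, p-landed), nothing weaker or
  stronger; the size half is an `↔` on the levels `k ≤ P.K` (`size_towerOf_iff`).

WHAT IS *NOT* CLAIMED.  No configuration is asserted regular; no minimiser, no averaging identity (item S-Q), no Green's function
(item S-GREEN); the adjoint representation (the intended `ι` for 𝔤-valued fluctuation fields) is any `ι` here; plaquette-smallness ⇒
bond-smallness is `T4AxialGaugeSmallField`'s, not repeated.  Value = the dictionary every «operator species as a function of U»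
reads (NE5 `Slots.rawA∕rawB`, NE9 O-NE9-1, NE7 NODE O), typed ONCE; NOT summit progress.

CITATION HEADER.  T. Bałaban, *Propagators for lattice gauge theories in a background field*, Commun. Math. Phys. **99** (1985)
389–434 [Balaban1985BackgroundPropagators] — (3.3) p. 390 (covariant derivative, the SHAPE of `covDc`), (3.35) p. 396 (the regularity
class, the SHAPE of `RegularTransporters`); T. Bałaban, *Averaging operations for lattice gauge theories*, Commun. Math. Phys. **98**
(1985) 17–51 [Balaban1985Averaging] — (3), (8) pp. 18–19, (19) p. 21.  Cited for KIND ∕ locus only; nothing printed is a hypothesis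
or conclusion below.  Imports BY NAME: `Support/RegularBackgroundTower` (hence `ColourCovariantLaplacian`, `BlockMultiplication`,
`BalabanAveragedTowerUnit`, `B5Prop11Plancherel`, `B5G183RateUnitTower`), `UnitaryModel`, `Setup`; nothing existing is modified.
-/

noncomputable section

open scoped BigOperators Matrix Kronecker Matrix.Norms.L2Operator

namespace Summit.QuantumFields.BalabanUV.T4Continuum.SubstrateBackgroundTransporters

open Literature.MathematicalPhysics.QuantumFieldTheory.Balaban1983to89
open Literature.MathematicalPhysics.QuantumFieldTheory.Balaban1983to89.B5Prop11Plancherel (Tor unitVec shiftM fdiff fine)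
open Literature.MathematicalPhysics.QuantumFieldTheory.Balaban1983to89.B5G183RateUnitTower (lev lev_neZero)
open Summit.QuantumFields.BalabanUV.T4Continuum.BalabanAveragedTowerUnit (idx cast_lev')
open Summit.QuantumFields.BalabanUV.T4Continuum.BlockMultiplication (siteMul siteMul_apply siteMul_one)
open Summit.QuantumFields.BalabanUV.T4Continuum.BlockPairingGeometry (tau)
open Summit.QuantumFields.BalabanUV.T4Continuum.ColourCovariantLaplacian (covDc covLapC lapC connM covDc_eq)
open Summit.QuantumFields.BalabanUV.T4Continuum.RegularBackgroundTower (RegularTransporters)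

/-! ## §1 Charts: V1 sites ARE V2 torus points -/

section Charts

variable (P : Params) (j : ℕ)

/-- [folklore] The constant moduli of the V1 lattice `T^{(j)}`: `P.sitesPerDir j = 2·L^{m+K−j}` in every direction. -/
abbrev modAt : Fin P.d → ℕ := fun _ => P.sitesPerDir j

/-- [folklore] **THE CHART** `Site P j ≃ Tor (modAt P j)` — DEFINITIONAL: both sides are `(μ : Fin d) → ZMod (2·L^{m+K−j})`. -/
def siteTor : Site P j ≃ Tor (modAt P j) := Equiv.refl _

/-- [folklore] The chart is the identity on underlying functions. -/
@[simp] theorem siteTor_apply (x : Site P j) (μ : Fin P.d) : siteTor P j x μ = x μ := rfl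

/-- [folklore] … and so is its inverse. -/
@[simp] theorem siteTor_symm_apply (x : Tor (modAt P j)) (μ : Fin P.d) : ((siteTor P j).symm x : Site P j) μ = x μ := rfl

/-- [folklore] `Site.shift` IS translation by the unit vector: `e(x + e_μ) = e(x) + unitVec μ`. -/
theorem siteTor_shift (x : Site P j) (μ : Fin P.d) : siteTor P j (x.shift μ) = siteTor P j x + unitVec (modAt P j) μ := by
  funext ν
  simp only [siteTor_apply, Site.shift, Pi.add_apply, unitVec]
  by_cases h : ν = μ
  · subst h; rw [Function.update_self, Pi.single_eq_same]
  · rw [Function.update_of_ne h, Pi.single_eq_of_ne h, add_zero]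

/-- [folklore] The unit-lattice moduli of a run: `2·L^m` sites per direction (the unit torus `T_1`, `Params.sitesPerDir P.K`). -/
abbrev unitMod : Fin P.d → ℕ := fun _ => 2 * P.L ^ P.m

/-- [folklore] `L ≠ 0` as an instance (`Params.L_pos`), needed by the NE2 tower index `idx P.L`. -/
instance instNeZeroL : NeZero P.L := ⟨P.L_pos.ne'⟩

/-- [folklore] `2·L^m ≠ 0` as an instance. -/
instance instNeZeroUnitMod (μ : Fin P.d) : NeZero (unitMod P μ) :=
  ⟨mul_ne_zero two_ne_zero (pow_ne_zero _ P.L_pos.ne')⟩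

variable {j} in
/-- [folklore] THE MODULI ALONG THE TOWER: at V1 level `j` with `j + k = K`, `P.sitesPerDir j = L^k · (2L^m) = fine (lev L k) (unitMod P)`
(NE2's recursively defined `lev L k` is `L^k`, `VariationalDelKBridge.lev_eq_pow` ∕ `BalabanAveragedTowerUnit.cast_lev'`). -/
theorem sitesPerDir_eq_fine {k : ℕ} (h : j + k = P.K) (μ : Fin P.d) : P.sitesPerDir j = fine (lev P.L k) (unitMod P) μ := by
  have hlev : ∀ n : ℕ, lev P.L n = P.L ^ n := by
    intro n
    induction n with
    | zero => rfl
    | succ n ih =>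
        show P.L * lev P.L n = P.L ^ (n + 1)
        rw [ih, pow_succ, mul_comm]
  simp only [Params.sitesPerDir, fine, hlev]
  have hK : P.m + P.K - j = P.m + k := by omega
  rw [hK, pow_add]
  ring

variable {j} in
/-- [folklore] **THE TOWER CHART**: V1 level `j` of the run IS NE2's level `k = K − j` lattice over the unit torus of periods `2L^m`
(coordinatewise `ZMod.ringEquivCongr` along `sitesPerDir_eq_fine`). -/
def siteIdx {k : ℕ} (h : j + k = P.K) : Site P j ≃ Tor (fine (lev P.L k) (unitMod P)) :=
  Equiv.piCongrRight fun μ => (ZMod.ringEquivCongr (sitesPerDir_eq_fine P h μ)).toEquiv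

variable {j} in
/-- [folklore] The tower chart, coordinatewise, is the ring isomorphism `ZMod.ringEquivCongr`. -/
theorem siteIdx_apply {k : ℕ} (h : j + k = P.K) (x : Site P j) (μ : Fin P.d) :
    siteIdx P h x μ = ZMod.ringEquivCongr (sitesPerDir_eq_fine P h μ) (x μ) :=
  rfl

variable {j} in
/-- [folklore] The tower chart is shift-compatible: `e(x + e_μ) = e(x) + unitVec μ`. -/
theorem siteIdx_shift {k : ℕ} (h : j + k = P.K) (x : Site P j) (μ : Fin P.d) :
    siteIdx P h (x.shift μ) = siteIdx P h x + unitVec _ μ := by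
  funext ν
  rw [Pi.add_apply, siteIdx_apply, siteIdx_apply]
  simp only [Site.shift, unitVec]
  by_cases hν : ν = μ
  · subst hν; rw [Function.update_self, Pi.single_eq_same, map_add, map_one]
  · rw [Function.update_of_ne hν, Pi.single_eq_of_ne hν, add_zero]

end Charts

/-! ## §2 Transporters of a gauge field through a representation, relative to a chart -/

section Transporters

variable {P : Params} {j : ℕ} {N : Fin P.d → ℕ} (e : Site P j ≃ Tor N)
variable {G : Type*} [GaugeGroup G] {o : Type*} [Fintype o] [DecidableEq o] (ι : G →* Matrix o o ℂ)

/-- [folklore] **THE VECTOR (1-form) TRANSPORTERS OF `U`**: `R_ν(x, μ) := ι (U(x, x + e_ν))` for every component index `μ` — the datum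
`R` of `ColourCovariantLaplacian.covDc` («e.g. the adjoint representation of U(x, x + ηe_ν)»). -/
def transV (U : GaugeField P j G) : Fin P.d → (Tor N × Fin P.d → Matrix o o ℂ) := fun ν i => ι (U ⟨e.symm i.1, ν⟩)

/-- [folklore] THE SCALAR (0-form) TRANSPORTERS OF `U`: `R_ν(x) := ι (U(x, x + e_ν))` (the datum of `ScalarCovariantLaplacian.scovD`). -/
def transS (U : GaugeField P j G) : Fin P.d → (Tor N → Matrix o o ℂ) := fun ν x => ι (U ⟨e.symm x, ν⟩)

/-- [folklore] `transV` unfolded. -/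
@[simp] theorem transV_apply (U : GaugeField P j G) (ν : Fin P.d) (i : Tor N × Fin P.d) :
    transV e ι U ν i = ι (U ⟨e.symm i.1, ν⟩) := rfl

/-- [folklore] `transS` unfolded. -/
@[simp] theorem transS_apply (U : GaugeField P j G) (ν : Fin P.d) (x : Tor N) : transS e ι U ν x = ι (U ⟨e.symm x, ν⟩) := rfl

/-- [folklore] The vector transporters are component-blind: `R_ν(x, μ) = R_ν(x)`. -/
theorem transV_eq_transS (U : GaugeField P j G) (ν : Fin P.d) (i : Tor N × Fin P.d) :
    transV e ι U ν i = transS e ι U ν i.1 := rfl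

/-- [folklore] In the chart's own coordinates: `R_ν(e x, μ) = ι (U(x, x + e_ν))`. -/
theorem transV_chart (U : GaugeField P j G) (ν μ : Fin P.d) (x : Site P j) : transV e ι U ν (e x, μ) = ι (U ⟨x, ν⟩) := by
  rw [transV_apply, Equiv.symm_apply_apply]

/-- [folklore] THE TRIVIAL CONFIGURATION HAS TRIVIAL TRANSPORTERS: `U = 1 ↦ R = 1`. -/
@[simp] theorem transV_one : transV e ι (1 : GaugeField P j G) = fun _ _ => 1 := by
  funext ν i
  exact map_one ι

/-- [folklore] `U = 1 ↦ R = 1`, scalar version. -/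
@[simp] theorem transS_one : transS e ι (1 : GaugeField P j G) = fun _ _ => 1 := by
  funext ν x
  exact map_one ι

/-- [folklore] **THE GAUGE LAW OF THE DICTIONARY** ([Balaban1985Averaging] (8) p. 19 `U^u(x, x') = u(x)U(x, x')u(x')⁻¹`, read through
`ι`): `R^{U^u}_ν(x, μ) = ι(u(x))·R^U_ν(x, μ)·ι(u(x + e_ν)⁻¹)`. -/
theorem transV_gaugeAct (u : GaugeTransf P j G) (U : GaugeField P j G) (ν : Fin P.d) (i : Tor N × Fin P.d) :
    transV e ι (GaugeField.gaugeAct u U) ν i =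
      ι (u (e.symm i.1)) * transV e ι U ν i * ι ((u ((e.symm i.1).shift ν))⁻¹) := by
  simp only [transV_apply, GaugeField.gaugeAct, map_mul]
  rfl

variable {ι} in
/-- [folklore] Unitary-valued representations give unitary transporters. -/
theorem transV_mem_unitaryGroup (hι : ∀ g, ι g ∈ Matrix.unitaryGroup o ℂ) (U : GaugeField P j G) (ν : Fin P.d)
    (i : Tor N × Fin P.d) : transV e ι U ν i ∈ Matrix.unitaryGroup o ℂ :=
  hι _

variable {ι} in
/-- [folklore] … hence transporters of operator norm one (`o` nonempty). -/
theorem norm_transV [Nonempty o] (hι : ∀ g, ι g ∈ Matrix.unitaryGroup o ℂ) (U : GaugeField P j G) (ν : Fin P.d)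
    (i : Tor N × Fin P.d) : ‖transV e ι U ν i‖ = 1 :=
  UnitaryModel.norm_of_mem_unitaryGroup (hι _)

variable {ι} in
/-- [folklore] **THE SIZE LETTER**: when `ι` realises the gauge group's distance to `1` (`‖ι g − 1‖ = dist1 g` — `rfl` for
`GaugeGroup.ofUnitaryRep`, e.g. the tree's `U(n)`, `SU(n)`), the transporter's distance to `1` IS the bond variable's:
`‖R_ν(x, μ) − 1‖ = dist1 (U(x, x + e_ν))`. -/
theorem norm_transV_sub_one (hdist : ∀ g, ‖ι g - 1‖ = dist1 g) (U : GaugeField P j G) (ν : Fin P.d) (i : Tor N × Fin P.d) :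
    ‖transV e ι U ν i - 1‖ = dist1 (U ⟨e.symm i.1, ν⟩) :=
  hdist _

end Transporters

/-! ## §3 The covariant vector Laplacian OF A GAUGE FIELD (V2 operator at V1 data); `U = 1` gives the free one -/

section Laplacian

variable {P : Params} {j : ℕ} {N : Fin P.d → ℕ} [hN : ∀ μ, NeZero (N μ)] (e : Site P j ≃ Tor N)
variable {G : Type*} [GaugeGroup G] {o : Type*} [Fintype o] [DecidableEq o] (ι : G →* Matrix o o ℂ)

/-- [folklore] **`Δ_U` ON `ι`-VALUED VECTOR FIELDS**: the covariant vector Laplacian `Σ_ν (∇^R_ν)ᴴ∇^R_ν` of `ColourCovariantLaplacian` at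
the transporters of `U` (lattice factor `c = η⁻¹`). -/
def covLapOf (c : ℂ) (U : GaugeField P j G) : Matrix ((Tor N × Fin P.d) × o) ((Tor N × Fin P.d) × o) ℂ :=
  covLapC N c (transV e ι U)

omit [Fintype o] [DecidableEq o] hN in
/-- [folklore] `siteMul` of the zero field is the zero operator. -/
theorem siteMul_zero {κ : Type*} [DecidableEq κ] : siteMul (fun _ : κ => (0 : Matrix o o ℂ)) = 0 := by
  ext a b
  rw [siteMul_apply]
  split_ifs <;> rfl

omit hN in
/-- [folklore] The trivial configuration has zero connection: `w_ν = c·(R_ν − 1) = 0` at `U = 1`. -/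
theorem connM_transV_one (c : ℂ) (ν : Fin P.d) : connM N c (transV e ι (1 : GaugeField P j G)) ν = fun _ => 0 := by
  funext i
  rw [transV_one]
  simp [connM]

/-- [folklore] At `U = 1` the covariant difference IS the free difference lifted to colour: `∇^1_ν = ∇_ν ⊗ 1`. -/
theorem covDc_transV_one (c : ℂ) (ν : Fin P.d) :
    covDc N c (transV e ι (1 : GaugeField P j G)) ν = fdiff N c ν ⊗ₖ (1 : Matrix o o ℂ) := by
  rw [covDc_eq, connM_transV_one, siteMul_zero, Matrix.zero_mul, add_zero]

/-- [folklore] **AT `U = 1` THE COVARIANT LAPLACIAN OF THE DICTIONARY IS NE2's FREE LAPLACIAN `Δ ⊗ 1`** (`ColourCovariantLaplacian.lapC`,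
tier A) — the anchor of every «perturbation of the free operator» statement of row NE2. -/
theorem covLapOf_one (c : ℂ) : covLapOf e ι c (1 : GaugeField P j G) = lapC N c := by
  simp only [covLapOf, covLapC, covDc_transV_one]
  rfl

end Laplacian

/-! ## §4 The tower of a run and the (3.35)-shape class in V1 words -/

section Tower

variable (P : Params) {G : Type*} [GaugeGroup G] {o : Type*} [Fintype o] [DecidableEq o] (ι : G →* Matrix o o ℂ)

/-- [folklore] **THE TRANSPORTER TOWER OF A RUN**: one V1 configuration per lattice `T^{(j)}` (`U j`, e.g. the background at that
level), read at NE2's level `k = K − j` through the tower chart; levels `k > K` (no V1 lattice) are set to `1`. -/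
def towerOf (U : (j : ℕ) → GaugeField P j G) (k : ℕ) : Fin P.d → (idx P.L (unitMod P) k → Matrix o o ℂ) :=
  if h : k ≤ P.K then transV (siteIdx P (j := P.K - k) (k := k) (by omega)) ι (U (P.K - k)) else fun _ _ => 1

variable {P}

/-- [folklore] In range: level `k ≤ K` of the tower is the transporter field of `U (K − k)`. -/
theorem towerOf_of_le (U : (j : ℕ) → GaugeField P j G) {k : ℕ} (h : k ≤ P.K) :
    towerOf P ι U k = transV (siteIdx P (j := P.K - k) (k := k) (by omega)) ι (U (P.K - k)) := by
  rw [towerOf, dif_pos h]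

/-- [folklore] Out of range: levels `k > K` are `1`. -/
theorem towerOf_of_lt (U : (j : ℕ) → GaugeField P j G) {k : ℕ} (h : P.K < k) : towerOf P ι U k = fun _ _ => 1 := by
  rw [towerOf, dif_neg (not_le.mpr h)]

/-- [folklore] In range, in the chart's coordinates: `R^{(k)}_ν(e x, μ) = ι (U_{K−k}(x, x + e_ν))`. -/
theorem towerOf_chart (U : (j : ℕ) → GaugeField P j G) {k : ℕ} (h : k ≤ P.K) (ν μ : Fin P.d) (x : Site P (P.K - k)) :
    towerOf P ι U k ν (siteIdx P (j := P.K - k) (k := k) (by omega) x, μ) = ι (U (P.K - k) ⟨x, ν⟩) := by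
  rw [towerOf_of_le ι U h, transV_chart]

variable {ι}

omit [Fintype o] [DecidableEq o] in
/-- [folklore] The level factor as a complex scalar has norm `L^k` (`BalabanAveragedTowerUnit.cast_lev'` BY NAME). -/
theorem norm_lev (k : ℕ) : ‖((lev P.L k : ℕ) : ℂ)‖ = (P.L : ℝ) ^ k := by
  rw [Complex.norm_natCast, cast_lev']

/-- [folklore] The V1 SIZE hypothesis at level `j = K − k` (bond variables within `α·L^{−k}` of `1`), read through a `dist1`-realising
`ι`, GIVES the size clause of `RegularTransporters` at NE2 level `k ≤ K`. -/
theorem size_towerOf_of_le (hdist : ∀ g, ‖ι g - 1‖ = dist1 g) (U : (j : ℕ) → GaugeField P j G) {k : ℕ} (hk : k ≤ P.K) {α : ℝ}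
    (hU : ∀ b : PBond P (P.K - k), (P.L : ℝ) ^ k * dist1 (U (P.K - k) b) ≤ α) (ν : Fin P.d) (i : idx P.L (unitMod P) k) :
    ‖((lev P.L k : ℕ) : ℂ) • (towerOf P ι U k ν i - 1)‖ ≤ α := by
  rw [towerOf_of_le ι U hk, norm_smul, transV_apply, hdist, norm_lev]
  exact hU _

/-- [folklore] … and CONVERSELY the size clause at a level `k ≤ K` gives back the V1 size hypothesis (the chart is onto). -/
theorem size_of_towerOf (hdist : ∀ g, ‖ι g - 1‖ = dist1 g) (U : (j : ℕ) → GaugeField P j G) {k : ℕ} (hk : k ≤ P.K) {α : ℝ}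
    (hR : ∀ (ν : Fin P.d) (i : idx P.L (unitMod P) k), ‖((lev P.L k : ℕ) : ℂ) • (towerOf P ι U k ν i - 1)‖ ≤ α)
    (b : PBond P (P.K - k)) : (P.L : ℝ) ^ k * dist1 (U (P.K - k) b) ≤ α := by
  have h := hR b.dir (siteIdx P (j := P.K - k) (k := k) (by omega) b.src, b.dir)
  rwa [towerOf_chart ι U hk, norm_smul, hdist, norm_lev] at h

/-- [folklore] THE SIZE HALF IS AN EQUIVALENCE on the levels of the run. -/
theorem size_towerOf_iff (hdist : ∀ g, ‖ι g - 1‖ = dist1 g) (U : (j : ℕ) → GaugeField P j G) {k : ℕ} (hk : k ≤ P.K) (α : ℝ) :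
    (∀ (ν : Fin P.d) (i : idx P.L (unitMod P) k), ‖((lev P.L k : ℕ) : ℂ) • (towerOf P ι U k ν i - 1)‖ ≤ α) ↔
      ∀ b : PBond P (P.K - k), (P.L : ℝ) ^ k * dist1 (U (P.K - k) b) ≤ α :=
  ⟨fun hR => size_of_towerOf hdist U hk hR, fun hU => size_towerOf_of_le hdist U hk hU⟩

/-- [folklore] Out of range the size clause is `0 ≤ α`. -/
theorem size_towerOf_of_lt (U : (j : ℕ) → GaugeField P j G) {k : ℕ} (hk : P.K < k) {α : ℝ} (hα : 0 ≤ α) (ν : Fin P.d)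
    (i : idx P.L (unitMod P) k) : ‖((lev P.L k : ℕ) : ℂ) • (towerOf P ι U k ν i - 1)‖ ≤ α := by
  rw [towerOf_of_lt ι U hk, sub_self, smul_zero, norm_zero]
  exact hα

/-- [folklore] The neighbour in direction `μ` of a charted site is the chart of the V1-shifted site (`tau` = `+ unitVec` on the site). -/
theorem tau_siteIdx {j k : ℕ} (h : j + k = P.K) (μ ν : Fin P.d) (x : Site P j) :
    tau (fine (lev P.L k) (unitMod P)) μ (siteIdx P h x, ν) = (siteIdx P h (x.shift μ), ν) := by
  rw [siteIdx_shift]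
  rfl

/-- [folklore] The V1 LATTICE-LIPSCHITZ hypothesis at level `j = K − k` (`ι`-images of neighbouring bond variables within `β·L^{−2k}`)
GIVES the Lipschitz clause of `RegularTransporters` at NE2 level `k ≤ K`. -/
theorem lipschitz_towerOf_of_le (U : (j : ℕ) → GaugeField P j G) {k : ℕ} (hk : k ≤ P.K) {β : ℝ}
    (hU : ∀ (x : Site P (P.K - k)) (ν μ : Fin P.d),
      (P.L : ℝ) ^ k * ‖ι (U (P.K - k) ⟨x.shift μ, ν⟩) - ι (U (P.K - k) ⟨x, ν⟩)‖ ≤ β / (P.L : ℝ) ^ k)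
    (ν μ : Fin P.d) (i : idx P.L (unitMod P) k) :
    ‖((lev P.L k : ℕ) : ℂ) • (towerOf P ι U k ν (tau (fine (lev P.L k) (unitMod P)) μ i) - towerOf P ι U k ν i)‖ ≤
      β / (lev P.L k : ℕ) := by
  obtain ⟨y, μ'⟩ := i
  obtain ⟨x, rfl⟩ := (siteIdx P (j := P.K - k) (k := k) (by omega)).surjective y
  rw [tau_siteIdx, towerOf_chart ι U hk, towerOf_chart ι U hk, norm_smul, norm_lev, cast_lev']
  exact hU x ν μ

/-- [folklore] Out of range the Lipschitz clause is `0 ≤ β`. -/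
theorem lipschitz_towerOf_of_lt (U : (j : ℕ) → GaugeField P j G) {k : ℕ} (hk : P.K < k) {β : ℝ} (hβ : 0 ≤ β) (ν μ : Fin P.d)
    (i : idx P.L (unitMod P) k) :
    ‖((lev P.L k : ℕ) : ℂ) • (towerOf P ι U k ν (tau (fine (lev P.L k) (unitMod P)) μ i) - towerOf P ι U k ν i)‖ ≤
      β / (lev P.L k : ℕ) := by
  rw [towerOf_of_lt ι U hk, sub_self, smul_zero, norm_zero]
  positivity

/-- [folklore] **THE (3.35)-SHAPE CLASS IN V1 WORDS**: if at every level `j = K − k` of the run the bond variables are within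
`α·L^{−k}` of `1` in `dist1` and their `ι`-images are lattice-Lipschitz with constant `β·L^{−2k}`, then the transporter tower of
the run lies in row NE2's hypothesis class `RegularTransporters P.L (unitMod P) (towerOf P ι U) α β` — the V2 wording of the SAME
hypothesis, nothing asserted about any particular configuration. -/
theorem regularTransporters_towerOf (hdist : ∀ g, ‖ι g - 1‖ = dist1 g) (U : (j : ℕ) → GaugeField P j G) {α β : ℝ}
    (hα : 0 ≤ α) (hβ : 0 ≤ β)
    (hsize : ∀ k, k ≤ P.K → ∀ b : PBond P (P.K - k), (P.L : ℝ) ^ k * dist1 (U (P.K - k) b) ≤ α)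
    (hlip : ∀ k, k ≤ P.K → ∀ (x : Site P (P.K - k)) (ν μ : Fin P.d),
      (P.L : ℝ) ^ k * ‖ι (U (P.K - k) ⟨x.shift μ, ν⟩) - ι (U (P.K - k) ⟨x, ν⟩)‖ ≤ β / (P.L : ℝ) ^ k) :
    RegularTransporters P.L (unitMod P) (towerOf P ι U) α β where
  nonneg := ⟨hα, hβ⟩
  size := fun k ν i => by
    rcases le_or_gt k P.K with hk | hk
    · exact size_towerOf_of_le hdist U hk (hsize k hk) ν i
    · exact size_towerOf_of_lt U hk hα ν i
  lipschitz := fun k ν μ i => by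
    rcases le_or_gt k P.K with hk | hk
    · exact lipschitz_towerOf_of_le U hk (hlip k hk) ν μ i
    · exact lipschitz_towerOf_of_lt U hk hβ ν μ i

omit [Fintype o] [DecidableEq o] in
/-- [folklore] The trivial configuration is `1` on every bond (unfolding lemma for `Setup`'s `One (GaugeField P j G)`). -/
theorem gaugeField_one_apply {j : ℕ} (b : PBond P j) : (1 : GaugeField P j G) b = 1 := rfl

/-- [folklore] NON-VACUITY: the tower of the trivial configurations (`U j = 1` at every level) lies in the class with `α = β = 0`
(`dist1 1 = 0`). -/
theorem regularTransporters_towerOf_one (hdist : ∀ g, ‖ι g - 1‖ = dist1 g) :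
    RegularTransporters P.L (unitMod P) (towerOf P ι (fun j => (1 : GaugeField P j G))) 0 0 :=
  regularTransporters_towerOf hdist _ le_rfl le_rfl
    (fun k _ b => by simp only [gaugeField_one_apply, GaugeGroup.dist1_one, mul_zero, le_refl])
    (fun k _ x ν μ => by simp only [gaugeField_one_apply, sub_self, norm_zero, mul_zero, zero_div, le_refl])

end Tower

end Summit.QuantumFields.BalabanUV.T4Continuum.SubstrateBackgroundTransporters

end
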